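import Summits.ABC.IUTFork.Cor312SlotHull
import Summits.ABC.IUTFork.Cor312StatementHullSetLocality
import Summits.ABC.IUTFork.Cor312PilotIdelesM
import HarnessLib

/-!
# [IUTchIII] Corollary 3.12 IN READING (P) — slot-reading HULL-SET LOCALITY: the per-slot-image quantities of the typed statement read the
# mono-analytic log-volume ONLY on the hull-sets of the frames; hence the two M-LEVEL sharp settings (frames route / summand route) have THE SAME
# `thetaSlotLocal`, `ThetaSlotFinite`, `−|log(Θ)|_(P)` and `SlotStatement`

PROOF-ONLY file (D-0012; no definitions, no `Prop` facts, nothing re-typed) of the abc-iut cell (R2 S-chain team, seat abc-iut-s2-p2 gen 4,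
self-named row «U-P-JUNCTION-M», part (iii-a) of the junction series (i) `Cor312SlotHullJunction` p464035 / (ii) `Cor312SlotHullJunctionK`
p464613). TAKES NO SIDE on [IUTchIII] Cor. 3.12, on the reading (U)/(P) of `−|log(Θ)|`, or on any author. The M-level slot READ itself
(`negLogThetaSlot (settingPrVolSharpM …) = ↑I.negLogThetaPerImageNonarch`) is abc-iut-C-cert-2's `Cor312ThetaSlotM` chain and is NOT touched here.

S. Mochizuki, *Inter-universal Teichmüller theory III* [Mochizuki2012]: Cor. 3.12 p. 173 l. 43 – p. 174 l. 18 and proof Step (x) p. 181;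
Rmk. 3.9.5 (i)(ii) p. 127 (the holomorphic hull is defined on, and the log-volume is read on, hull-sets `λ·𝒪_L`); Thm. 3.11 (i) (Ind2) p. 154.
T. Dupuy, A. Hilado [DupuyHilado2025] §4.9, §4.11–4.12 (one hull per (Ind2)-slot image: READING (P), abc-iut-C-cert-2's `Cor312SlotHull`
p458847 — `thetaSlotImages`, `thetaSlotHull`, `SlotHullDefined`, `thetaSlotLocal`, `ThetaSlotFinite`, `negLogThetaSlot`, `SlotStatement`).

* §1 (`Cor312.HullSetLocality`, generic — the SLOT twin of abc-iut-c312-6's `Cor312StatementHullSetLocality`): two typed settings over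
  `Situation.ofShells L …` (SAME log-shell signature; arbitrary, possibly different admissible regions, log-volumes, archimedean structures,
  splitting monoids, global realified Frobenioids) with the same frames and (Ind3)-regions and log-volumes AGREEING ON HULL-SETS have the same
  `thetaSlotImages`, `thetaSlotHull`, `SlotHullDefined`, **`thetaSlotLocal`**, `ThetaSlotFinite`, **`negLogThetaSlot`**, and (with the same
  `q`-regions) **`slotStatement_iff_of_agree`** — reading (P), like reading (U), consumes the line data ONLY through the log-volume on hull-sets.
* §2 (`Thm311.Real`, M level): abc-iut-w5-d166's frames-route sharp setting `settingMSharp` (p435453; the setting of the M-line certificates) and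
  abc-iut-s2-p8's summand-route sharp setting `settingPrVolSharpM` (p438078; the setting of the M-level READs over `presAtM`) have THE SAME slot
  quantities: `thetaSlotLocal_settingMSharp_eq_settingPrVolSharpM`, `thetaSlotFinite_settingMSharp_iff_settingPrVolSharpM`,
  **`negLogThetaSlot_settingMSharp_eq_settingPrVolSharpM`**, **`slotStatement_settingMSharp_iff_settingPrVolSharpM`** (abc-iut-w4-d013's
  `settingMSharp_eq_settingPrFramesM` + `frame_/thetaRegion3_/qRegion_/logvol_agree_on_hul_settingPrFramesM`, p436551/p437121, and §1) —
  the reading-(P) twin of abc-iut-w4-d013's `thetaLocal_settingMSharp_eq` / `negLogTheta_settingMSharp_eq` / `statement_settingMSharp_iff`: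
  a slot READ or bound proved on either route is one on the other.

HONEST SCOPE: bookkeeping identities between OUR typings; nothing asserts either statement at any datum; typed ≠ proved.
[cite: Mochizuki2012, IUTchIII Cor. 3.12 p. 173–174, proof Step (x) p. 181; Rmk. 3.9.5 (i)(ii) p. 127; Thm. 3.11 (i) p. 154]
[cite: Mochizuki2012, IUTchI Def. 3.1 (e) p. 62] [cite: DupuyHilado2025, §4.9, §4.11–4.12] [claim: Mochizuki2012, status: disputed] for every
quoted construction.
-/

noncomputable section

open Set Function NumberField IsDedekindDomain

/-! ## §1. Slot-reading HULL-SET LOCALITY (generic over `Situation.ofShells`) -/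

namespace Summit.ABC.IUTFork.Cor312.HullSetLocality

open Thm311 Setting Literature.IUT.LogThetaLattice Literature.IUT.LogVolume

variable {T : ThetaIndex} {L : LogShells T}
  {M₁ : Type} [Field M₁] [NumberField M₁] {M₂ : Type} [Field M₂] [NumberField M₂]
  {archPk₁ archPk₂ : ∀ (j : T.Label) (vQ : T.VQ), Set (L.Packet j vQ)}
  {archSub₁ archSub₂ : ∀ (j : T.Label) (v : T.V), Set (L.Packet j (T.over v))}
  {Adm₁ Adm₂ : ∀ (j : T.Label) (vQ : T.VQ), Set (L.Packet j vQ) → Prop}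
  {logvol₁ logvol₂ : ∀ (j : T.Label) (vQ : T.VQ), Set (L.Packet j vQ) → ℝ}
  {Ψ₁ Ψ₂ : ℤ → ∀ v : T.V, v ∈ T.Vbad → Set (L.StarPacket v)}
  {act₁ act₂ : ℤ → ∀ v : T.V, v ∈ T.Vbad → L.StarPacket v → Module.End ℚ (L.StarPacket v)}
  {Mmod₁ Mmod₂ : ℤ → ∀ j : T.LabelStar, Set (L.GlobalPacket j.1)}
  {region₁ : ℤ → ∀ j : T.LabelStar, FinDivisor M₁ → ∀ vQ : T.VQ, Set (L.Packet j.1 vQ)}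
  {region₂ : ℤ → ∀ j : T.LabelStar, FinDivisor M₂ → ∀ vQ : T.VQ, Set (L.Packet j.1 vQ)}
  (P₁ : Setting (Situation.ofShells L M₁ archPk₁ archSub₁ Adm₁ logvol₁ Ψ₁ act₁ Mmod₁ region₁))
  (P₂ : Setting (Situation.ofShells L M₂ archPk₂ archSub₂ Adm₂ logvol₂ Ψ₂ act₂ Mmod₂ region₂))

open scoped Classical in
/-- Over `Situation.ofShells`, the local SLOT term of ANY setting is `logvol` of the slot hull when that hull is defined, `+∞` otherwise
(the slot twin of abc-iut-c312-6's `thetaLocal_eq_ite`). [folklore] -/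
theorem thetaSlotLocal_eq_ite (j : T.Label) (vQ : T.VQ) :
    P₁.thetaSlotLocal j vQ =
      if P₁.SlotHullDefined j vQ then ((logvol₁ j vQ (P₁.thetaSlotHull j vQ) : ℝ) : WithTop ℝ) else ⊤ :=
  rfl

/-- Under `SlotHullDefined` the slot hull is a hull-set of the frame (`HullFrame.hull_mem_of_hasHull`). [folklore] -/
theorem thetaSlotHull_mem_hul {j : T.Label} {vQ : T.VQ} (h : P₁.SlotHullDefined j vQ) :
    P₁.thetaSlotHull j vQ ∈ (P₁.frame j vQ).Hul :=
  (P₁.frame j vQ).hull_mem_of_hasHull h.1 h.2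

section Agree

variable {P₁ P₂}
  (hframe : ∀ (j : T.Label) (vQ : T.VQ), P₁.frame j vQ = P₂.frame j vQ)
  (hθ : ∀ (j : T.Label) (vQ : T.VQ), P₁.thetaRegion3 j vQ = P₂.thetaRegion3 j vQ)
  (hqR : ∀ (j : T.Label) (vQ : T.VQ), P₁.qRegion j vQ = P₂.qRegion j vQ)
  (hagree : ∀ (j : T.Label) (vQ : T.VQ), ∀ H ∈ (P₁.frame j vQ).Hul, logvol₁ j vQ H = logvol₂ j vQ H)

include hθ in
/-- Same (Ind3)-regions ⟹ same (Ind2)-SLOT images of the Θ-pilot object (the (Ind2)-families are those of the common `L`).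
[cite: Mochizuki2012, IUTchIII Thm. 3.11 (i) (Ind2) p. 154] [claim: Mochizuki2012, status: disputed] -/
theorem thetaSlotImages_eq (j : T.Label) (vQ : T.VQ) : P₁.thetaSlotImages j vQ = P₂.thetaSlotImages j vQ := by
  unfold Setting.thetaSlotImages
  rw [hθ j vQ]
  rfl

include hframe hθ in
/-- … and, with the same frames, the same SLOT hull. [cite: DupuyHilado2025, §4.12] [claim: Mochizuki2012, status: disputed] -/
theorem thetaSlotHull_eq (j : T.Label) (vQ : T.VQ) : P₁.thetaSlotHull j vQ = P₂.thetaSlotHull j vQ := by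
  unfold Setting.thetaSlotHull
  rw [hframe j vQ, thetaSlotImages_eq hθ j vQ]
  rfl

include hframe hθ in
/-- … and the same `SlotHullDefined`. [folklore] -/
theorem slotHullDefined_iff (j : T.Label) (vQ : T.VQ) : P₁.SlotHullDefined j vQ ↔ P₂.SlotHullDefined j vQ := by
  unfold Setting.SlotHullDefined
  rw [hframe j vQ, thetaSlotImages_eq hθ j vQ]
  exact Iff.rfl

include hframe hθ hagree in
/-- **Same local SLOT term `−|log(Θ)|^{(P)}_{j,v_ℚ}`**: when defined, the slot hull is a hull-set of the (common) frame, where the two log-volumes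
agree; otherwise both read `+∞`. [cite: Mochizuki2012, IUTchIII Rmk. 3.9.5 (i)(ii) p. 127; Cor. 3.12 proof Step (x) p. 181]
[claim: Mochizuki2012, status: disputed] -/
theorem thetaSlotLocal_eq (j : T.Label) (vQ : T.VQ) : P₁.thetaSlotLocal j vQ = P₂.thetaSlotLocal j vQ := by
  rw [thetaSlotLocal_eq_ite P₁, thetaSlotLocal_eq_ite P₂]
  by_cases h : P₁.SlotHullDefined j vQ
  · rw [if_pos h, if_pos ((slotHullDefined_iff hframe hθ j vQ).mp h), ← thetaSlotHull_eq hframe hθ j vQ,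
      hagree j vQ _ (thetaSlotHull_mem_hul P₁ h)]
  · rw [if_neg h, if_neg (mt (slotHullDefined_iff hframe hθ j vQ).mpr h)]

include hframe hθ hagree in
/-- **Same `ThetaSlotFinite`** ("`−|log(Θ)|_(P) ∈ ℝ`"). [claim: Mochizuki2012, status: disputed] -/
theorem thetaSlotFinite_iff : P₁.ThetaSlotFinite ↔ P₂.ThetaSlotFinite := by
  simp only [Setting.ThetaSlotFinite, thetaSlotLocal_eq hframe hθ hagree]

include hframe hθ hagree in
/-- **Same `−|log(Θ)|_(P)`** (the procession-normalised sum of the slot-hull log-volumes). [cite: Mochizuki2012, IUTchIII Cor. 3.12 proof Step (x)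
p. 181] [cite: DupuyHilado2025, §4.12] [claim: Mochizuki2012, status: disputed] -/
theorem negLogThetaSlot_eq : P₁.negLogThetaSlot = P₂.negLogThetaSlot := by
  unfold Setting.negLogThetaSlot
  by_cases h : P₂.ThetaSlotFinite
  · rw [if_pos ((thetaSlotFinite_iff hframe hθ hagree).mpr h), if_pos h]
    simp only [thetaSlotLocal_eq hframe hθ hagree]
  · rw [if_neg (mt (thetaSlotFinite_iff hframe hθ hagree).mp h), if_neg h]

include hframe hθ hqR hagree in
/-- **HULL-SET LOCALITY OF THE TYPED COROLLARY 3.12 IN READING (P).** Two typed settings over situations built on the SAME log-shell signature,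
with the same hull frames, the same (Ind3)-Θ-regions and `q`-regions, and log-volumes that AGREE ON THE HULL-SETS of the frames, satisfy the
reading-(P) statement "`−|log(Θ)|_(P) ∈ ℝ` and `−|log(Θ)|_(P) ≥ −|log(q)|`" (abc-iut-C-cert-2 `SlotStatement`) SIMULTANEOUSLY — whatever their
admissible regions, archimedean structures, splitting monoids and global realified Frobenioids. Neither side is asserted.
[cite: Mochizuki2012, IUTchIII Cor. 3.12 p. 174 l. 16–18, proof Step (x) p. 181] [claim: Mochizuki2012, status: disputed] -/
theorem slotStatement_iff_of_agree : P₁.SlotStatement ↔ P₂.SlotStatement := by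
  unfold Setting.SlotStatement
  rw [negLogThetaSlot_eq hframe hθ hagree, negLogQ_eq hqR hagree]

end Agree

end Summit.ABC.IUTFork.Cor312.HullSetLocality

/-! ## §2. M level: the frames-route and the summand-route sharp settings have THE SAME slot quantities -/

namespace Summit.ABC.IUTFork.Thm311.Real

open Cor312 Cor312Vol Literature.IUT.LogThetaLattice Literature.IUT.LogVolume Literature.IUT.HodgeTheaters
  Literature.NumberTheory.NumberFields

section Routes

variable {F K Fbar : Type} [Field F] [NumberField F] [Field K] [NumberField K] [Algebra F K]
  [Field Fbar] [Algebra F Fbar] [Algebra K Fbar] {E : WeierstrassCurve F} [E.IsElliptic] {l : ℕ}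
  {Pb : BadPlacePredicates K} (D : InitialThetaData F K Fbar E l Pb) {logvK : PadicLogsVal K}
  (hlog : LogvAnalyticVal logvK) (M : Type) [Field M] [NumberField M]
  (archPk : ∀ (j : (thetaIndexOfInitial D).Label) (vQ : (thetaIndexOfInitial D).VQ),
    Set ((logShellsOfInitialDH D logvK).Packet j vQ))
  (archSub : ∀ (j : (thetaIndexOfInitial D).Label) (v : (thetaIndexOfInitial D).V),
    Set ((logShellsOfInitialDH D logvK).Packet j ((thetaIndexOfInitial D).over v)))
  (Ψ : ℤ → ∀ v : (thetaIndexOfInitial D).V, v ∈ (thetaIndexOfInitial D).Vbad →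
    Set ((logShellsOfInitialDH D logvK).StarPacket v))
  (act : ℤ → ∀ v : (thetaIndexOfInitial D).V, v ∈ (thetaIndexOfInitial D).Vbad →
    (logShellsOfInitialDH D logvK).StarPacket v → Module.End ℚ ((logShellsOfInitialDH D logvK).StarPacket v))
  (Mmod : ℤ → ∀ j : (thetaIndexOfInitial D).LabelStar, Set ((logShellsOfInitialDH D logvK).GlobalPacket j.1))
  (region : ℤ → ∀ j : (thetaIndexOfInitial D).LabelStar, FinDivisor M → ∀ vQ : (thetaIndexOfInitial D).VQ,
    Set ((logShellsOfInitialDH D logvK).Packet j.1 vQ))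
  (n : ℤ) {HT : Type} {LogLink : HT → HT → Type} {IsFull : ∀ {s t : HT}, LogLink s t → Prop}
  (lat : LGPGaussianLogThetaLattice LogLink IsFull)
  {Frd : Type} {IsoF : Frd → Frd → Type} {Ob : Frd → Type} {realify : Frd → Frd} {Strip : Type}
  {IsoS : Strip → Strip → Type}
  {Mv : ∀ v : (thetaIndexOfInitial D).V, v ∈ (thetaIndexOfInitial D).Vbad → Type} [∀ v h, Monoid (Mv v h)]
  (sig : GlobalLGPFrobenioidSignature (thetaIndexOfInitial D).lstar (thetaIndexOfInitial D).V
    (· ∈ (thetaIndexOfInitial D).Vbad) Frd IsoF Ob realify Strip IsoS Mv)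
  (split : SplittingMonoids Mv) {ObΔ : Type}
  {N : ∀ v : (thetaIndexOfInitial D).V, v ∈ (thetaIndexOfInitial D).Vbad → Type} [∀ v h, Monoid (N v h)]
  (qData : QPilotData ObΔ N)
  (t : ∀ (u : FinitePlace ℚ) (_ : Fin (thetaIndexOfInitial D).lstar) (x : (thetaIndexOfInitial D).Fibre (Val.non u)),
    kOfM D (ratChar u) u (natCast_ratChar_mem u) x)
  (tq : ∀ (u : FinitePlace ℚ) (x : (thetaIndexOfInitial D).Fibre (Val.non u)),
    kOfM D (ratChar u) u (natCast_ratChar_mem u) x)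
  (htq0 : ∀ u x, tq u x ≠ 0) (Sq : Finset (FinitePlace ℚ))
  (htq1 : ∀ (u : FinitePlace ℚ) (x : (thetaIndexOfInitial D).Fibre (Val.non u)), u ∉ Sq → ‖tq u x‖ = 1)

/-- **Same local SLOT term on the two routes**: abc-iut-w5-d166's frames-route `settingMSharp` IS abc-iut-w4-d013's field-box twin
`settingPrFramesM` at the sharp binders (`settingMSharp_eq_settingPrFramesM`, `rfl`), which has the frames and (Ind3)-regions of the summand-route
`settingPrVolM` at those binders — i.e. of abc-iut-s2-p8's `settingPrVolSharpM` — and a log-volume agreeing with it on hull-sets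
(`logvol_agree_on_hul_settingPrFramesM`); §1. [cite: Mochizuki2012, IUTchIII Rmk. 3.9.5 (i)(ii) p. 127; Cor. 3.12 proof Step (x) p. 181]
[claim: Mochizuki2012, status: disputed] -/
theorem thetaSlotLocal_settingMSharp_eq_settingPrVolSharpM (j : (thetaIndexOfInitial D).Label) (vQ : (thetaIndexOfInitial D).VQ) :
    (settingMSharp D hlog M archPk archSub Ψ act Mmod region n lat sig split qData t tq htq0 Sq htq1).thetaSlotLocal j vQ =
      (settingPrVolSharpM D hlog t tq M archPk archSub Ψ act Mmod region n lat sig split qData htq0 Sq htq1).thetaSlotLocal j vQ := by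
  rw [settingMSharp_eq_settingPrFramesM]
  exact HullSetLocality.thetaSlotLocal_eq
    (frame_settingPrFramesM D hlog M archPk archSub Ψ act Mmod region n lat sig split qData _ _ _ _)
    (thetaRegion3_settingPrFramesM D hlog M archPk archSub Ψ act Mmod region n lat sig split qData _ _ _ _)
    (logvol_agree_on_hul_settingPrFramesM D hlog M archPk archSub Ψ act Mmod region n lat sig split qData _ _ _ _) j vQ

/-- **Same `ThetaSlotFinite`** on the two routes. [claim: Mochizuki2012, status: disputed] -/
theorem thetaSlotFinite_settingMSharp_iff_settingPrVolSharpM :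
    (settingMSharp D hlog M archPk archSub Ψ act Mmod region n lat sig split qData t tq htq0 Sq htq1).ThetaSlotFinite ↔
      (settingPrVolSharpM D hlog t tq M archPk archSub Ψ act Mmod region n lat sig split qData htq0 Sq htq1).ThetaSlotFinite := by
  rw [settingMSharp_eq_settingPrFramesM]
  exact HullSetLocality.thetaSlotFinite_iff
    (frame_settingPrFramesM D hlog M archPk archSub Ψ act Mmod region n lat sig split qData _ _ _ _)
    (thetaRegion3_settingPrFramesM D hlog M archPk archSub Ψ act Mmod region n lat sig split qData _ _ _ _)
    (logvol_agree_on_hul_settingPrFramesM D hlog M archPk archSub Ψ act Mmod region n lat sig split qData _ _ _ _)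

/-- **Same `−|log(Θ)|_(P)` on the two routes** — a reading-(P) bound or READ proved at either M-level sharp setting is one at the other.
[cite: Mochizuki2012, IUTchIII Cor. 3.12 proof Step (x) p. 181] [cite: DupuyHilado2025, §4.12] [claim: Mochizuki2012, status: disputed] -/
theorem negLogThetaSlot_settingMSharp_eq_settingPrVolSharpM :
    (settingMSharp D hlog M archPk archSub Ψ act Mmod region n lat sig split qData t tq htq0 Sq htq1).negLogThetaSlot =
      (settingPrVolSharpM D hlog t tq M archPk archSub Ψ act Mmod region n lat sig split qData htq0 Sq htq1).negLogThetaSlot := by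
  rw [settingMSharp_eq_settingPrFramesM]
  exact HullSetLocality.negLogThetaSlot_eq
    (frame_settingPrFramesM D hlog M archPk archSub Ψ act Mmod region n lat sig split qData _ _ _ _)
    (thetaRegion3_settingPrFramesM D hlog M archPk archSub Ψ act Mmod region n lat sig split qData _ _ _ _)
    (logvol_agree_on_hul_settingPrFramesM D hlog M archPk archSub Ψ act Mmod region n lat sig split qData _ _ _ _)

/-- **Same reading-(P) Statement `SlotStatement` on the two routes.** [cite: Mochizuki2012, IUTchIII Cor. 3.12 p. 174 l. 16–18, proof Step (x)
p. 181] [claim: Mochizuki2012, status: disputed] -/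
theorem slotStatement_settingMSharp_iff_settingPrVolSharpM :
    (settingMSharp D hlog M archPk archSub Ψ act Mmod region n lat sig split qData t tq htq0 Sq htq1).SlotStatement ↔
      (settingPrVolSharpM D hlog t tq M archPk archSub Ψ act Mmod region n lat sig split qData htq0 Sq htq1).SlotStatement := by
  rw [settingMSharp_eq_settingPrFramesM]
  exact HullSetLocality.slotStatement_iff_of_agree
    (frame_settingPrFramesM D hlog M archPk archSub Ψ act Mmod region n lat sig split qData _ _ _ _)
    (thetaRegion3_settingPrFramesM D hlog M archPk archSub Ψ act Mmod region n lat sig split qData _ _ _ _)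
    (qRegion_settingPrFramesM D hlog M archPk archSub Ψ act Mmod region n lat sig split qData _ _ _ _)
    (logvol_agree_on_hul_settingPrFramesM D hlog M archPk archSub Ψ act Mmod region n lat sig split qData _ _ _ _)

end Routes

end Summit.ABC.IUTFork.Thm311.Real

end
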